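import Mathlib
import Summits.MatrixMultiplication.MatrixMultiplication.Theorems.SnSubsetDichotomyNoThresholdSubsetTripleStubTransfer

/-!
# `SnSubsetDichotomy.NoThresholdSubsetTriple`, line `klr-graded-polynomial-method` — stub
# `stub_savingTransfer`

The transfer "MODULAR slice-rank saving `C⁺` ⇒ crux" (crux `stmt-MatrixMultiplication-8302`,
registered stub `stub_savingTransfer` of the line `klr-graded-polynomial-method`;
Blasiak–Church–Cohn–Grochow–Umans 2017, §6 and Prop. B.6).  If for some `c > 0` and all large `n`
there is a prime `p` with `slice-rank_{𝔽_p} D_{S_n} ≤ n!·e^{−c√n}`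
(`D_G(x,y,z) = [xyz = 1]` = `mulGroupTensor (ZMod p) (Equiv.Perm (Fin n))`), then every triple
`S, T, U ⊆ S_n` with the triple product property has `|S||T||U| ≤ (n!)^{3/2}·e^{−(c/2)√n}` for the
same large `n`, i.e. `NoThresholdSubsetTriple` holds with constant `c/2` and the same threshold.

This is literally the sibling tree theorem `stub_transfer` (file
`SnSubsetDichotomyNoThresholdSubsetTripleStubTransfer.lean`, fixed field `F`) with the field
`ZMod p` chosen AFTER `n`: fix `n ≥ n₀`, take the prime `p` and the bound from the hypothesis, and
suppose a TPP triple has `|S||T||U| > (n!)^{3/2} e^{−(c/2)√n}`.  The sets are non-empty; packing in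
three rotations (`tpp_perm_card_mul_le_min_mul_factorial`) gives `|S||T||U| ≤ N·n!` for
`N := min(|S|,|T|,|U|)`, hence `√(n!)·e^{−(c/2)√n} < N` and `n!·e^{−c√n} < N²`; shrinking to
`N`-subsets (`tpp_perm_realizesTPP_of_le`), `S_n` realizes `⟨N,N,N⟩`, so
`N² ≤ slice-rank_{𝔽_p} D_{S_n}` by
`BCCGU2017_propB6.sq_le_sliceRank_of_realizesTPP BCCGU2017_propB6_holds (ZMod p)` — contradiction.
The GENUINE three-fold triple product property is used (through `RealizesTPP`).
-/

namespace Summit.MatrixMultiplication.MatrixMultiplication.Theorems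

open Literature.Barriers.MatrixMultiplication Literature.Combinatorics.Additive
open Literature.Computability.AlgebraicComplexity
open Summit.MatrixMultiplication.MatrixMultiplication.Theses.SnSubsetDichotomy

set_option linter.dupNamespace false in -- deliberate Summit.<S>.<P> duplicate
/-- **Real bookkeeping of the transfer.**  If `f > 0`, `f^{3/2}·e^{−(c/2)s} < P` and `P ≤ N·f`,
then `f·e^{−c s} < N²` (divide by `f`, square, `e^{−(c/2)s}·e^{−(c/2)s} = e^{−c s}`). [folklore] -/
theorem factorial_mul_exp_lt_sq_of_threshold {f c s P N : ℝ} (hf : 0 < f)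
    (hlt : f ^ ((3 : ℝ) / 2) * Real.exp (-(c / 2 * s)) < P) (hP : P ≤ N * f) :
    f * Real.exp (-(c * s)) < N ^ 2 := by
  set e : ℝ := Real.exp (-(c / 2 * s)) with hedef
  have he : 0 < e := Real.exp_pos _
  have hrpow : f ^ ((3 : ℝ) / 2) = f * Real.sqrt f := by
    rw [Real.rpow_div_two_eq_sqrt _ hf.le, Real.rpow_ofNat, pow_succ, Real.sq_sqrt hf.le]
  have hee : e * e = Real.exp (-(c * s)) := by
    rw [hedef, ← Real.exp_add]
    congr 1
    ring
  have h1 : f * Real.sqrt f * e < N * f :=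
    calc f * Real.sqrt f * e = f ^ ((3 : ℝ) / 2) * e := by rw [hrpow]
      _ < P := hlt
      _ ≤ N * f := hP
  have h2 : Real.sqrt f * e < N := by
    refine lt_of_mul_lt_mul_left (a := f) ?_ hf.le
    calc f * (Real.sqrt f * e) = f * Real.sqrt f * e := (mul_assoc _ _ _).symm
      _ < N * f := h1
      _ = f * N := mul_comm _ _
  have h0 : 0 ≤ Real.sqrt f * e := mul_nonneg (Real.sqrt_nonneg _) he.le
  calc f * Real.exp (-(c * s)) = (Real.sqrt f * e) ^ 2 := by
        rw [mul_pow, Real.sq_sqrt hf.le, sq e, hee]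
    _ < N ^ 2 := pow_lt_pow_left₀ h2 h0 two_ne_zero

set_option linter.dupNamespace false in -- deliberate Summit.<S>.<P> duplicate
/-- **Stub `stub_savingTransfer` — the transfer `C⁺ → crux` (line `klr-graded-polynomial-method`
of crux `SnSubsetDichotomy.NoThresholdSubsetTriple`).**  If for some `c > 0` and every large `n`
there is a prime `p` such that the slice rank over `𝔽_p = ZMod p` of
`D_{S_n}(x,y,z) = [xyz = 1]` is `≤ n!·e^{−c√n}`, then `NoThresholdSubsetTriple` holds (with
constant `c/2` and the same `n₀`).
Proof: fix `n ≥ n₀`, the prime `p` and the bound at `n`, and a TPP triple `S, T, U` with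
`|S||T||U| > (n!)^{3/2}e^{−(c/2)√n}`; the sets are non-empty, packing in its three rotations
(`tpp_perm_card_mul_le_min_mul_factorial`) gives `|S||T||U| ≤ N·n!` for `N := min(|S|,|T|,|U|)`,
hence `N² > n!·e^{−c√n}` (`factorial_mul_exp_lt_sq_of_threshold`); shrinking to `N`-subsets,
`S_n` realizes `⟨N,N,N⟩` (`tpp_perm_realizesTPP_of_le`), whence
`N² ≤ sliceRank (mulGroupTensor (ZMod p) S_n)` by the tree theorem
`BCCGU2017_propB6.sq_le_sliceRank_of_realizesTPP BCCGU2017_propB6_holds` (`ZMod p` is a field as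
`p` is prime) — contradiction.  The genuine three-fold triple product property is used.
[cite: BlasiakChurchCohnGrochowUmans2017, §6 and Prop. B.6] -/
theorem stub_savingTransfer :
    (∃ c : ℝ, 0 < c ∧ ∃ n₀ : ℕ, ∀ n ≥ n₀, ∃ p : ℕ, p.Prime ∧
      (Literature.Barriers.MatrixMultiplication.sliceRank
          (Literature.Barriers.MatrixMultiplication.mulGroupTensor (ZMod p) (Equiv.Perm (Fin n))) : ℝ) ≤
        (n.factorial : ℝ) * Real.exp (-(c * Real.sqrt (n : ℝ)))) →
      Summit.MatrixMultiplication.MatrixMultiplication.Theses.SnSubsetDichotomy.NoThresholdSubsetTriple := by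
  intro h
  obtain ⟨c, hc, n₀, hC⟩ := h
  unfold NoThresholdSubsetTriple
  refine ⟨c / 2, half_pos hc, n₀, fun n hn S T U hTPP => ?_⟩
  by_contra hlt
  rw [not_le] at hlt
  -- the modular slice-rank hypothesis at `n`: a prime `p` and the bound over `ZMod p`
  obtain ⟨p, hp, hCn⟩ := hC n hn
  haveI : Fact p.Prime := ⟨hp⟩
  -- (i) the three sets are non-empty
  have hprod : 0 < S.card * T.card * U.card := by
    have h0 : (0 : ℝ) < ((S.card * T.card * U.card : ℕ) : ℝ) := lt_of_le_of_lt (by positivity) hlt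
    exact_mod_cast h0
  have hS0 : S.card ≠ 0 := fun h0 => by simp [h0] at hprod
  have hT0 : T.card ≠ 0 := fun h0 => by simp [h0] at hprod
  have hU0 : U.card ≠ 0 := fun h0 => by simp [h0] at hprod
  -- (ii)+(iii) packing in three rotations: `|S||T||U| ≤ N · n!` for the minimum `N`
  have hNprod := tpp_perm_card_mul_le_min_mul_factorial hTPP hS0 hT0 hU0
  have hNS : min S.card (min T.card U.card) ≤ S.card := min_le_left _ _
  have hNT : min S.card (min T.card U.card) ≤ T.card := (min_le_right _ _).trans (min_le_left _ _)
  have hNU : min S.card (min T.card U.card) ≤ U.card :=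
    (min_le_right _ _).trans (min_le_right _ _)
  generalize min S.card (min T.card U.card) = N at hNprod hNS hNT hNU
  -- (iv) shrink: `S_n` realizes `⟨N,N,N⟩`, so `N² ≤ slice-rank_{𝔽_p} D_{S_n}`
  have hR : RealizesTPP (Equiv.Perm (Fin n)) N N N := tpp_perm_realizesTPP_of_le hTPP hNS hNT hNU
  have hsq : ((N : ℝ)) ^ 2 ≤ (sliceRank (mulGroupTensor (ZMod p) (Equiv.Perm (Fin n))) : ℝ) := by
    exact_mod_cast BCCGU2017_propB6.sq_le_sliceRank_of_realizesTPP BCCGU2017_propB6_holds (ZMod p)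
      (Equiv.Perm (Fin n)) hR
  -- (v) real bookkeeping: `n! · e^{-c√n} < N²`
  have hf : (0 : ℝ) < (n.factorial : ℝ) := by exact_mod_cast Nat.factorial_pos n
  have hP : ((S.card * T.card * U.card : ℕ) : ℝ) ≤ (N : ℝ) * (n.factorial : ℝ) := by
    exact_mod_cast hNprod
  have h3 := factorial_mul_exp_lt_sq_of_threshold hf hlt hP
  -- contradiction with `C⁺` at `n`
  exact absurd (hsq.trans hCn) (not_le.2 h3)

end Summit.MatrixMultiplication.MatrixMultiplication.Theorems
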